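import Mathlib
import HarnessLib
import Summits.Ventures.LatticeQCDFlow.Exactness.SUNOmf2TrajectoryEnergyError
import Summits.Ventures.LatticeQCDFlow.Exactness.SUNMomentumLawMoments
import Summits.Ventures.LatticeQCDFlow.Exactness.GaugeFTHMCSymmetricWord

/-!
# THE MEAN ACCEPTANCE OF THE ENGINE'S `n`-STEP `SU(N)` OMF2 PROPOSAL IN GENERAL COORDINATES IS AT LEAST `1 − O(nδ²)`, EXPLICITLY: the pointwise OMF2 energy-error law averaged over the Gaussian momentum refresh, from every configuration

HONEST FRAMING: exact (Metropolis-corrected) sampling algorithms for lattice gauge theory;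
figures of merit are autocorrelation/cost numbers at stated couplings and volumes; no
continuum-physics claim.

Venture `LatticeQCDFlow` (cell pub-lqcd), topic `Exactness`; FANOUT row 14 (`eng-flowhmc`, family B, `integrator = "omf2"`;
the row's mean-acceptance column for the OMF2 proposal on the `SU(N)` rung of rows 21–26).  The OMF2 twin of
`SUNLeapfrogMeanAcceptance`.  NEW WORK of the cell over `SUNOmf2TrajectoryEnergyError`
(`abs_sunOmf2ProposalN_energy_error_le`: pointwise `|ΔH| ≤ n·βK·A|δ|(‖p‖ + b₂)(c₈(Σ_l‖p_l‖ + c₁) + c₂)` with `A = N²C_ι`,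
`γ₂ = (2|λ|+|1−2λ|)D_max/κ`, `b₂ = (n+1)γ₂`, `c₈ = |1−2λ|+2|λ|+1`, `c₁ = (n+1)|L|γ₂`, `c₂ = 4λ²|L|D_max/κ`),
`SUNMomentumLawMoments` (`E Σ_l‖p_l‖ ≤ |L|√(d/(2κ))`, `E (Σ_l‖p_l‖)² ≤ |L|²d/(2κ)` under `sunMomentumLaw μ (κΣ‖p_l‖²)`),
`GaugeFTHMCSymmetricWord` (`measurable_flip_omf2Word_pow`; the proposal is the object of `Omf2ProposalLaws` §0); nothing is cited as a fact; no number.  SETTING as in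
`SUNOmf2EnergyError` with the pairing normalised to the norm, `B(x,x) = ‖x‖²`, so that the kinetic term `κΣ_l B(p_l,p_l)` is
the exponent `κΣ_l‖p_l‖²` of the refresh law (`μ` any additive Haar measure on the `d`-dimensional coordinate space).

* **`sunOmf2ProposalN_meanAcceptance_ge`** — from EVERY configuration `q`:
  `∫ min(1, e^{−ΔH(q,p)}) d(refresh)(p) ≥ 1 − n·βK·A|δ|·(c₈|L|²d/(2κ) + (c₈(b₂ + c₁) + c₂)|L|√(d/(2κ)) + b₂(c₈c₁ + c₂))`
  — `1 − O(nδ²)` once `K, D_max = O(δ)`, uniformly in `q`;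
* **`sunOmf2ProposalN_meanAcceptance_ge_integral`** — the same for the `ν ⊗ refresh` average, ANY probability law `ν` of
  the configuration.

NOT CLAIMED: the equilibrium average as an identity; optimal constants; the engine's own coordinates (`sunKinetic` is not
`‖·‖²` of the sup norm — see `SUNEnginePairing`); floating point; any number.
-/

noncomputable section

namespace Summit.Ventures.LatticeQCDFlow.Exactness

open Set Function MeasureTheory NormedSpace
open scoped Matrix Matrix.Norms.Operator ENNReal

set_option backward.isDefEq.respectTransparency false

section MeanAcceptance

variable {n : Type*} [Fintype n] [DecidableEq n]
variable {E : Type*} [NormedAddCommGroup E] [NormedSpace ℝ E] [FiniteDimensional ℝ E] [Nontrivial E]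
  [MeasurableSpace E] [BorelSpace E] (μ : Measure E) [μ.IsAddHaarMeasure]
variable (ι : E →ₗ[ℝ] Matrix n n ℂ) (hι : ∀ a, (ι a)ᴴ = -ι a ∧ (ι a).trace = 0)
variable (B : E →ₗ[ℝ] E →ₗ[ℝ] ℝ)
variable {L : Type*} [Fintype L]

set_option maxHeartbeats 400000 in -- RN-23 (7)(b): heavy declaration budgeted at source (lake build ≈ 10 % hungrier than the gate)
/-- **THE MEAN ACCEPTANCE OF THE ENGINE'S `n`-STEP `SU(N)` OMF2 PROPOSAL IS AT LEAST `1 − O(nδ²)`, EXPLICITLY**, from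
EVERY configuration `q` (hypotheses as in `abs_sunOmf2ProposalN_energy_error_le`, plus measurability of `S`, `D` and
`B(x,x) = ‖x‖²`): with `A = N²C_ι`, `γ₂ = (2|λ|+|1−2λ|)D_max/κ`, `b₂ = (n+1)γ₂`, `c₈ = |1−2λ|+2|λ|+1`, `c₁ = (n+1)|L|γ₂`,
`c₂ = 4λ²|L|D_max/κ`:
`∫ min(1, e^{−ΔH(q,p)}) dp ≥ 1 − n·βK·A|δ|·(c₈|L|²d/(2κ) + (c₈(b₂ + c₁) + c₂)|L|√(d/(2κ)) + b₂(c₈c₁ + c₂))`. -/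
theorem sunOmf2ProposalN_meanAcceptance_ge {Cι : ℝ} (hC0 : 0 ≤ Cι) (hCι : ∀ x : E, ‖ι x‖ ≤ Cι * ‖x‖)
    (S : (L → Matrix.specialUnitaryGroup n ℂ) → ℝ) (hS : Measurable S) (δ κ lam : ℝ) (hκ : 0 < κ)
    (hd : ∀ W : L → Matrix.specialUnitaryGroup n ℂ, DifferentiableAt ℝ (fun a : L → E => S (sunExpDrift ι hι δ a * W)) 0)
    (hBs : ∀ x y : E, B x y = B y x) (hBn : ∀ x : E, B x x = ‖x‖ ^ 2) {β : ℝ} (hβ0 : 0 ≤ β)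
    (hBβ : ∀ x y : E, |B x y| ≤ β * ‖x‖ * ‖y‖)
    (D g₁ g₂ : (L → Matrix.specialUnitaryGroup n ℂ) → L → E) (hDm : Measurable D)
    (hD : ∀ (W : L → Matrix.specialUnitaryGroup n ℂ) (v : L → E),
      fderiv ℝ (fun a : L → E => S (sunExpDrift ι hι δ a * W)) 0 v = ∑ l, B (D W l) (v l))
    {Dmax K : ℝ} (hD0 : 0 ≤ Dmax) (hK0 : 0 ≤ K)
    (hDb : ∀ (W : L → Matrix.specialUnitaryGroup n ℂ) (l : L), ‖D W l‖ ≤ Dmax)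
    (hDK : ∀ W W' : L → Matrix.specialUnitaryGroup n ℂ, ‖D W - D W'‖ ≤ K * ‖coeConfig W - coeConfig W'‖)
    (hg₁ : ∀ W l, g₁ W l = -(lam / κ) • D W l) (hg₂ : ∀ W l, g₂ W l = -((1 - 2 * lam) / κ) • D W l)
    (q : L → Matrix.specialUnitaryGroup n ℂ) (N : ℕ) :
    1 - N * (β * K * ((Fintype.card n : ℝ) ^ 2 * Cι) * |δ|) *
        ((|1 - 2 * lam| + 2 * |lam| + 1) * ((Fintype.card L : ℝ) ^ 2 * (Module.finrank ℝ E / (2 * κ))) +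
          ((|1 - 2 * lam| + 2 * |lam| + 1) * ((N + 1) * ((2 * |lam| + |1 - 2 * lam|) * (Dmax / κ)) +
              (N + 1) * (Fintype.card L * ((2 * |lam| + |1 - 2 * lam|) * (Dmax / κ)))) + 4 * lam ^ 2 * (Fintype.card L * Dmax / κ)) *
            (Fintype.card L * Real.sqrt (Module.finrank ℝ E / (2 * κ))) +
          (N + 1) * ((2 * |lam| + |1 - 2 * lam|) * (Dmax / κ)) *
            ((|1 - 2 * lam| + 2 * |lam| + 1) * ((N + 1) * (Fintype.card L * ((2 * |lam| + |1 - 2 * lam|) * (Dmax / κ)))) +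
              4 * lam ^ 2 * (Fintype.card L * Dmax / κ))) ≤
      ∫ p, min 1 (Real.exp (-((S (((flip : Equiv.Perm ((L → Matrix.specialUnitaryGroup n ℂ) × (L → E))) *
            omf2Word g₁ (mulDrift (sunExpDrift ι hι δ)) g₂ ^ N) (q, p)).1 +
          κ * ∑ l, ‖(((flip : Equiv.Perm ((L → Matrix.specialUnitaryGroup n ℂ) × (L → E))) *
            omf2Word g₁ (mulDrift (sunExpDrift ι hι δ)) g₂ ^ N) (q, p)).2 l‖ ^ 2) - (S q + κ * ∑ l, ‖p l‖ ^ 2))))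
        ∂(sunMomentumLaw (L := L) μ fun p => κ * ∑ l, ‖p l‖ ^ 2) := by
  haveI := isProbabilityMeasure_sunMomentumLaw_normSq (L := L) μ hκ
  -- abbreviations
  set γ₂ : ℝ := (2 * |lam| + |1 - 2 * lam|) * (Dmax / κ) with hγ₂
  set b₂ : ℝ := (N + 1) * γ₂ with hb₂
  set c₈ : ℝ := |1 - 2 * lam| + 2 * |lam| + 1 with hc₈
  set c₁ : ℝ := (N + 1) * (Fintype.card L * γ₂) with hc₁
  set c₂ : ℝ := 4 * lam ^ 2 * (Fintype.card L * Dmax / κ) with hc₂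
  set α : ℝ := c₈ * (b₂ + c₁) + c₂ with hα
  set C : ℝ := β * K * ((Fintype.card n : ℝ) ^ 2 * Cι) * |δ| with hC
  set Ψ := ((flip : Equiv.Perm ((L → Matrix.specialUnitaryGroup n ℂ) × (L → E))) *
    omf2Word g₁ (mulDrift (sunExpDrift ι hι δ)) g₂ ^ N) with hΨ
  have hγ₂0 : 0 ≤ γ₂ := by rw [hγ₂]; positivity
  have hb₂0 : 0 ≤ b₂ := by rw [hb₂]; positivity
  have hc₈0 : 0 ≤ c₈ := by rw [hc₈]; positivity
  have hc₁0 : 0 ≤ c₁ := by rw [hc₁]; positivity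
  have hc₂0 : 0 ≤ c₂ := by rw [hc₂]; positivity
  have hα0 : 0 ≤ α := by rw [hα]; positivity
  have hC0' : 0 ≤ C := by rw [hC]; positivity
  set ΔH : (L → E) → ℝ := fun p =>
    (S (Ψ (q, p)).1 + κ * ∑ l, ‖(Ψ (q, p)).2 l‖ ^ 2) - (S q + κ * ∑ l, ‖p l‖ ^ 2) with hΔH
  -- `1 − |x| ≤ min(1, e^{−x})`
  have hacc : ∀ x : ℝ, 1 - |x| ≤ min 1 (Real.exp (-x)) := by
    intro x
    rcases le_or_gt x 0 with hx | hx
    · rw [min_eq_left ((Real.one_le_exp_iff).2 (by linarith))]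
      linarith [abs_nonneg x]
    · rw [abs_of_pos hx]
      refine le_min (by linarith) ?_
      linarith [Real.add_one_le_exp (-x)]
  -- the sup norm is at most the link sum
  have hsup : ∀ p : L → E, ‖p‖ ≤ ∑ l, ‖p l‖ := fun p =>
    (pi_norm_le_iff_of_nonneg (Finset.sum_nonneg fun m _ => norm_nonneg (p m))).2 fun l =>
      Finset.single_le_sum (fun m _ => norm_nonneg (p m)) (Finset.mem_univ l)
  -- the pointwise energy-error law, as a polynomial in Σ_l ‖p_l‖
  have hpt : ∀ p : L → E, |ΔH p| ≤ N * C * (c₈ * (∑ l, ‖p l‖) ^ 2 + α * ∑ l, ‖p l‖ + b₂ * (c₈ * c₁ + c₂)) := by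
    intro p
    have h := abs_sunOmf2ProposalN_energy_error_le ι hι B hC0 hCι S δ κ lam hκ hd hBs hβ0 hBβ D g₁ g₂ hD hD0 hK0 hDb hDK hg₁ hg₂ q p N
    simp only [hBn] at h
    rw [← hΨ] at h
    have hs := hsup p
    have hs0 : 0 ≤ ∑ l, ‖p l‖ := Finset.sum_nonneg fun l _ => norm_nonneg _
    refine h.trans ?_
    rw [← hγ₂, ← hc₈]
    have hpos : 0 ≤ c₈ * (∑ l, ‖p l‖ + (N + 1) * (Fintype.card L * γ₂)) + 4 * lam ^ 2 * (Fintype.card L * Dmax / κ) := by positivity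
    calc (N : ℝ) * (β * K * ((Fintype.card n : ℝ) ^ 2 * Cι) * |δ| * (‖p‖ + (N + 1) * γ₂) *
          (c₈ * (∑ l, ‖p l‖ + (N + 1) * (Fintype.card L * γ₂)) + 4 * lam ^ 2 * (Fintype.card L * Dmax / κ)))
        ≤ N * (β * K * ((Fintype.card n : ℝ) ^ 2 * Cι) * |δ| * (∑ l, ‖p l‖ + (N + 1) * γ₂) *
          (c₈ * (∑ l, ‖p l‖ + (N + 1) * (Fintype.card L * γ₂)) + 4 * lam ^ 2 * (Fintype.card L * Dmax / κ))) := by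
          gcongr
      _ = N * C * (c₈ * (∑ l, ‖p l‖) ^ 2 + (c₈ * (b₂ + c₁) + c₂) * ∑ l, ‖p l‖ + b₂ * (c₈ * c₁ + c₂)) := by
          rw [hC, hb₂, hc₁, hc₂]; ring
  -- measurability of ΔH and integrability of both sides
  have hg₁fun : g₁ = fun W l => -(lam / κ) • D W l := funext fun W => funext fun l => hg₁ W l
  have hg₂fun : g₂ = fun W l => -((1 - 2 * lam) / κ) • D W l := funext fun W => funext fun l => hg₂ W l
  have hg₁m : Measurable g₁ := by rw [hg₁fun]; exact hDm.const_smul (-(lam / κ))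
  have hg₂m : Measurable g₂ := by rw [hg₂fun]; exact hDm.const_smul (-((1 - 2 * lam) / κ))
  have hΨm : Measurable (⇑Ψ) := by rw [hΨ]; exact measurable_flip_omf2Word_pow (measurable_sunExpDrift ι hι δ) hg₁m hg₂m N
  have hT : Measurable fun p : L → E => κ * ∑ l, ‖p l‖ ^ 2 := measurable_normSqKinetic κ
  have hΔm : Measurable ΔH := by
    rw [hΔH]
    have hq : Measurable fun p : L → E => Ψ (q, p) := hΨm.comp measurable_prodMk_left
    exact ((hS.comp (measurable_fst.comp hq)).add (hT.comp (measurable_snd.comp hq))).sub (measurable_const.add hT)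
  have hacc_int : Integrable (fun p => min 1 (Real.exp (-ΔH p))) (sunMomentumLaw (L := L) μ fun p => κ * ∑ l, ‖p l‖ ^ 2) := by
    refine (integrable_const (1 : ℝ)).mono' (measurable_const.min (hΔm.neg.exp)).aestronglyMeasurable
      (Filter.Eventually.of_forall fun p => ?_)
    rw [Real.norm_eq_abs, abs_of_nonneg (le_min zero_le_one (Real.exp_pos _).le)]
    exact min_le_left _ _
  have hint1 : Integrable (fun p : L → E => ∑ l, ‖p l‖) (sunMomentumLaw (L := L) μ fun p => κ * ∑ l, ‖p l‖ ^ 2) :=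
    integrable_finsetSum _ fun l _ => by simpa only [pow_one] using integrable_norm_apply_pow_sunMomentumLaw (L := L) μ hκ 1 l
  have hint2 : Integrable (fun p : L → E => (∑ l, ‖p l‖) ^ 2) (sunMomentumLaw (L := L) μ fun p => κ * ∑ l, ‖p l‖ ^ 2) := by
    have hint2' : Integrable (fun p : L → E => (Fintype.card L : ℝ) * ∑ l, ‖p l‖ ^ 2)
        (sunMomentumLaw (L := L) μ fun p => κ * ∑ l, ‖p l‖ ^ 2) :=
      (integrable_finsetSum _ fun l _ => integrable_norm_apply_pow_sunMomentumLaw (L := L) μ hκ 2 l).const_mul _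
    refine hint2'.mono' ((Finset.measurable_sum _ fun l _ => (measurable_pi_apply l).norm).pow_const 2).aestronglyMeasurable
      (Filter.Eventually.of_forall fun p => ?_)
    rw [Real.norm_eq_abs, abs_of_nonneg (sq_nonneg _)]
    have h := sq_sum_le_card_mul_sum_sq (s := Finset.univ) (f := fun l => ‖p l‖)
    simpa only [Finset.card_univ] using h
  have h8 : Integrable (fun p : L → E => c₈ * (∑ l, ‖p l‖) ^ 2) (sunMomentumLaw (L := L) μ fun p => κ * ∑ l, ‖p l‖ ^ 2) :=
    hint2.const_mul c₈
  have hαs : Integrable (fun p : L → E => α * ∑ l, ‖p l‖) (sunMomentumLaw (L := L) μ fun p => κ * ∑ l, ‖p l‖ ^ 2) :=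
    hint1.const_mul α
  have h8α : Integrable (fun p : L → E => c₈ * (∑ l, ‖p l‖) ^ 2 + α * ∑ l, ‖p l‖) (sunMomentumLaw (L := L) μ fun p => κ * ∑ l, ‖p l‖ ^ 2) :=
    h8.add hαs
  have hq3 : Integrable (fun p : L → E => c₈ * (∑ l, ‖p l‖) ^ 2 + α * ∑ l, ‖p l‖ + b₂ * (c₈ * c₁ + c₂))
      (sunMomentumLaw (L := L) μ fun p => κ * ∑ l, ‖p l‖ ^ 2) := h8α.add (integrable_const _)
  have hCq : Integrable (fun p : L → E => N * C * (c₈ * (∑ l, ‖p l‖) ^ 2 + α * ∑ l, ‖p l‖ + b₂ * (c₈ * c₁ + c₂)))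
      (sunMomentumLaw (L := L) μ fun p => κ * ∑ l, ‖p l‖ ^ 2) := hq3.const_mul _
  have hpoly_int : Integrable (fun p : L → E => 1 - N * C * (c₈ * (∑ l, ‖p l‖) ^ 2 + α * ∑ l, ‖p l‖ + b₂ * (c₈ * c₁ + c₂)))
      (sunMomentumLaw (L := L) μ fun p => κ * ∑ l, ‖p l‖ ^ 2) := (integrable_const _).sub hCq
  -- integrate the pointwise bound
  have hmono : ∫ p, (1 - N * C * (c₈ * (∑ l, ‖p l‖) ^ 2 + α * ∑ l, ‖p l‖ + b₂ * (c₈ * c₁ + c₂)))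
        ∂(sunMomentumLaw (L := L) μ fun p => κ * ∑ l, ‖p l‖ ^ 2) ≤
      ∫ p, min 1 (Real.exp (-ΔH p)) ∂(sunMomentumLaw (L := L) μ fun p => κ * ∑ l, ‖p l‖ ^ 2) :=
    integral_mono hpoly_int hacc_int fun p => ((sub_le_sub_left (hpt p) 1).trans (hacc (ΔH p)))
  -- evaluate the left-hand side with the moments of the refresh law
  have hlhs : ∫ p, (1 - N * C * (c₈ * (∑ l, ‖p l‖) ^ 2 + α * ∑ l, ‖p l‖ + b₂ * (c₈ * c₁ + c₂)))
        ∂(sunMomentumLaw (L := L) μ fun p => κ * ∑ l, ‖p l‖ ^ 2) =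
      1 - N * C * (c₈ * ∫ p, (∑ l, ‖p l‖) ^ 2 ∂(sunMomentumLaw (L := L) μ fun p => κ * ∑ l, ‖p l‖ ^ 2) +
        α * ∫ p, ∑ l, ‖p l‖ ∂(sunMomentumLaw (L := L) μ fun p => κ * ∑ l, ‖p l‖ ^ 2) + b₂ * (c₈ * c₁ + c₂)) := by
    rw [integral_sub (integrable_const _) hCq, integral_const, integral_const_mul, integral_add h8α (integrable_const _),
      integral_add h8 hαs, integral_const_mul, integral_const_mul, integral_const]
    simp only [probReal_univ, smul_eq_mul, one_mul]
  have hE2 := integral_sq_sum_norm_sunMomentumLaw_le (L := L) μ hκ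
  have hE1 := integral_sum_norm_sunMomentumLaw_le (L := L) μ hκ
  have hfin : 1 - N * C * (c₈ * ((Fintype.card L : ℝ) ^ 2 * (Module.finrank ℝ E / (2 * κ))) +
        α * (Fintype.card L * Real.sqrt (Module.finrank ℝ E / (2 * κ))) + b₂ * (c₈ * c₁ + c₂)) ≤
      1 - N * C * (c₈ * ∫ p, (∑ l, ‖p l‖) ^ 2 ∂(sunMomentumLaw (L := L) μ fun p => κ * ∑ l, ‖p l‖ ^ 2) +
        α * ∫ p, ∑ l, ‖p l‖ ∂(sunMomentumLaw (L := L) μ fun p => κ * ∑ l, ‖p l‖ ^ 2) + b₂ * (c₈ * c₁ + c₂)) := by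
    have hcoef : 0 ≤ (N : ℝ) * C := by positivity
    have h2 := mul_le_mul_of_nonneg_left hE2 hc₈0
    have h1 := mul_le_mul_of_nonneg_left hE1 hα0
    have h3 : (N : ℝ) * C * (c₈ * ∫ p, (∑ l, ‖p l‖) ^ 2 ∂(sunMomentumLaw (L := L) μ fun p => κ * ∑ l, ‖p l‖ ^ 2) +
        α * ∫ p, ∑ l, ‖p l‖ ∂(sunMomentumLaw (L := L) μ fun p => κ * ∑ l, ‖p l‖ ^ 2) + b₂ * (c₈ * c₁ + c₂)) ≤
        N * C * (c₈ * ((Fintype.card L : ℝ) ^ 2 * (Module.finrank ℝ E / (2 * κ))) +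
        α * (Fintype.card L * Real.sqrt (Module.finrank ℝ E / (2 * κ))) + b₂ * (c₈ * c₁ + c₂)) :=
      mul_le_mul_of_nonneg_left (by linarith) hcoef
    linarith
  have hgoal := (hfin.trans (hlhs.symm.le)).trans hmono
  rw [hα, hb₂, hc₁, hc₂, hc₈, hC, hγ₂] at hgoal
  simpa only [hΔH, hΨ] using hgoal

set_option maxHeartbeats 400000 in -- RN-23 (7)(b): heavy declaration budgeted at source (lake build ≈ 10 % hungrier than the gate)
/-- **… and therefore in ANY law of the configuration**: for every probability measure `ν` on the configurations the
`ν ⊗ refresh`-averaged acceptance probability of the engine's `n`-step OMF2 proposal obeys the same bound. -/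
theorem sunOmf2ProposalN_meanAcceptance_ge_integral {Cι : ℝ} (hC0 : 0 ≤ Cι) (hCι : ∀ x : E, ‖ι x‖ ≤ Cι * ‖x‖)
    (S : (L → Matrix.specialUnitaryGroup n ℂ) → ℝ) (hS : Measurable S) (δ κ lam : ℝ) (hκ : 0 < κ)
    (hd : ∀ W : L → Matrix.specialUnitaryGroup n ℂ, DifferentiableAt ℝ (fun a : L → E => S (sunExpDrift ι hι δ a * W)) 0)
    (hBs : ∀ x y : E, B x y = B y x) (hBn : ∀ x : E, B x x = ‖x‖ ^ 2) {β : ℝ} (hβ0 : 0 ≤ β)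
    (hBβ : ∀ x y : E, |B x y| ≤ β * ‖x‖ * ‖y‖)
    (D g₁ g₂ : (L → Matrix.specialUnitaryGroup n ℂ) → L → E) (hDm : Measurable D)
    (hD : ∀ (W : L → Matrix.specialUnitaryGroup n ℂ) (v : L → E),
      fderiv ℝ (fun a : L → E => S (sunExpDrift ι hι δ a * W)) 0 v = ∑ l, B (D W l) (v l))
    {Dmax K : ℝ} (hD0 : 0 ≤ Dmax) (hK0 : 0 ≤ K)
    (hDb : ∀ (W : L → Matrix.specialUnitaryGroup n ℂ) (l : L), ‖D W l‖ ≤ Dmax)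
    (hDK : ∀ W W' : L → Matrix.specialUnitaryGroup n ℂ, ‖D W - D W'‖ ≤ K * ‖coeConfig W - coeConfig W'‖)
    (hg₁ : ∀ W l, g₁ W l = -(lam / κ) • D W l) (hg₂ : ∀ W l, g₂ W l = -((1 - 2 * lam) / κ) • D W l)
    (ν : Measure (L → Matrix.specialUnitaryGroup n ℂ)) [IsProbabilityMeasure ν] (N : ℕ) :
    1 - N * (β * K * ((Fintype.card n : ℝ) ^ 2 * Cι) * |δ|) *
        ((|1 - 2 * lam| + 2 * |lam| + 1) * ((Fintype.card L : ℝ) ^ 2 * (Module.finrank ℝ E / (2 * κ))) +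
          ((|1 - 2 * lam| + 2 * |lam| + 1) * ((N + 1) * ((2 * |lam| + |1 - 2 * lam|) * (Dmax / κ)) +
              (N + 1) * (Fintype.card L * ((2 * |lam| + |1 - 2 * lam|) * (Dmax / κ)))) + 4 * lam ^ 2 * (Fintype.card L * Dmax / κ)) *
            (Fintype.card L * Real.sqrt (Module.finrank ℝ E / (2 * κ))) +
          (N + 1) * ((2 * |lam| + |1 - 2 * lam|) * (Dmax / κ)) *
            ((|1 - 2 * lam| + 2 * |lam| + 1) * ((N + 1) * (Fintype.card L * ((2 * |lam| + |1 - 2 * lam|) * (Dmax / κ)))) +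
              4 * lam ^ 2 * (Fintype.card L * Dmax / κ))) ≤
      ∫ q, ∫ p, min 1 (Real.exp (-((S (((flip : Equiv.Perm ((L → Matrix.specialUnitaryGroup n ℂ) × (L → E))) *
            omf2Word g₁ (mulDrift (sunExpDrift ι hι δ)) g₂ ^ N) (q, p)).1 +
          κ * ∑ l, ‖(((flip : Equiv.Perm ((L → Matrix.specialUnitaryGroup n ℂ) × (L → E))) *
            omf2Word g₁ (mulDrift (sunExpDrift ι hι δ)) g₂ ^ N) (q, p)).2 l‖ ^ 2) - (S q + κ * ∑ l, ‖p l‖ ^ 2))))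
        ∂(sunMomentumLaw (L := L) μ fun p => κ * ∑ l, ‖p l‖ ^ 2) ∂ν := by
  haveI := isProbabilityMeasure_sunMomentumLaw_normSq (L := L) μ hκ
  have hpt := fun q => sunOmf2ProposalN_meanAcceptance_ge μ ι hι B hC0 hCι S hS δ κ lam hκ hd hBs hBn hβ0 hBβ D g₁ g₂ hDm hD
    hD0 hK0 hDb hDK hg₁ hg₂ q N
  set Ψ := ((flip : Equiv.Perm ((L → Matrix.specialUnitaryGroup n ℂ) × (L → E))) *
    omf2Word g₁ (mulDrift (sunExpDrift ι hι δ)) g₂ ^ N) with hΨ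
  -- joint measurability of the acceptance probability
  have hg₁fun : g₁ = fun W l => -(lam / κ) • D W l := funext fun W => funext fun l => hg₁ W l
  have hg₂fun : g₂ = fun W l => -((1 - 2 * lam) / κ) • D W l := funext fun W => funext fun l => hg₂ W l
  have hg₁m : Measurable g₁ := by rw [hg₁fun]; exact hDm.const_smul (-(lam / κ))
  have hg₂m : Measurable g₂ := by rw [hg₂fun]; exact hDm.const_smul (-((1 - 2 * lam) / κ))
  have hΨm : Measurable (⇑Ψ) := by rw [hΨ]; exact measurable_flip_omf2Word_pow (measurable_sunExpDrift ι hι δ) hg₁m hg₂m N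
  have hT : Measurable fun p : L → E => κ * ∑ l, ‖p l‖ ^ 2 := measurable_normSqKinetic κ
  have hjoint : Measurable fun z : (L → Matrix.specialUnitaryGroup n ℂ) × (L → E) =>
      min 1 (Real.exp (-((S (Ψ z).1 + κ * ∑ l, ‖(Ψ z).2 l‖ ^ 2) - (S z.1 + κ * ∑ l, ‖z.2 l‖ ^ 2)))) :=
    measurable_const.min ((((hS.comp (measurable_fst.comp hΨm)).add (hT.comp (measurable_snd.comp hΨm))).sub
      ((hS.comp measurable_fst).add (hT.comp measurable_snd))).neg.exp)
  have hF : Integrable (fun q : L → Matrix.specialUnitaryGroup n ℂ => ∫ p, min 1 (Real.exp (-((S (Ψ (q, p)).1 +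
          κ * ∑ l, ‖(Ψ (q, p)).2 l‖ ^ 2) - (S q + κ * ∑ l, ‖p l‖ ^ 2))))
        ∂(sunMomentumLaw (L := L) μ fun p => κ * ∑ l, ‖p l‖ ^ 2)) ν := by
    refine (integrable_const (1 : ℝ)).mono' (hjoint.stronglyMeasurable.integral_prod_right'
      (ν := sunMomentumLaw (L := L) μ fun p => κ * ∑ l, ‖p l‖ ^ 2)).aestronglyMeasurable (Filter.Eventually.of_forall fun q => ?_)
    refine (norm_integral_le_of_norm_le_const (C := 1) (Filter.Eventually.of_forall fun p => ?_)).trans ?_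
    · rw [Real.norm_eq_abs, abs_of_nonneg (le_min zero_le_one (Real.exp_pos _).le)]
      exact min_le_left _ _
    · rw [probReal_univ, mul_one]
  calc _ = ∫ _q : L → Matrix.specialUnitaryGroup n ℂ, (1 - N * (β * K * ((Fintype.card n : ℝ) ^ 2 * Cι) * |δ|) *
        ((|1 - 2 * lam| + 2 * |lam| + 1) * ((Fintype.card L : ℝ) ^ 2 * (Module.finrank ℝ E / (2 * κ))) +
          ((|1 - 2 * lam| + 2 * |lam| + 1) * ((N + 1) * ((2 * |lam| + |1 - 2 * lam|) * (Dmax / κ)) +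
              (N + 1) * (Fintype.card L * ((2 * |lam| + |1 - 2 * lam|) * (Dmax / κ)))) + 4 * lam ^ 2 * (Fintype.card L * Dmax / κ)) *
            (Fintype.card L * Real.sqrt (Module.finrank ℝ E / (2 * κ))) +
          (N + 1) * ((2 * |lam| + |1 - 2 * lam|) * (Dmax / κ)) *
            ((|1 - 2 * lam| + 2 * |lam| + 1) * ((N + 1) * (Fintype.card L * ((2 * |lam| + |1 - 2 * lam|) * (Dmax / κ)))) +
              4 * lam ^ 2 * (Fintype.card L * Dmax / κ)))) ∂ν := by
          rw [integral_const, probReal_univ, one_smul]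
    _ ≤ _ := integral_mono (integrable_const _) hF hpt

end MeanAcceptance

end Summit.Ventures.LatticeQCDFlow.Exactness
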